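import Summits.CriticalPhenomena.PercolationContinuityZ3.Theorems.Transplant.SkelPhiRunKitClause
import Summits.CriticalPhenomena.PercolationContinuityZ3.Theorems.Transplant.SkelPhiRootBridgeGeom
import HarnessLib

/-!
# N1 (the `{±1}` node), (R) column (N1-R-PLAN v2 §4 (R5a); NEG-SCOPE B.13): THE KIT CLAUSE OF A WINDOW LEVEL IN THE ROOT FRAME —
# the bridge step of the root chain runs in the plain oriented frame `Skelφ.rootFrame φ t σ` (`w ↦ (σ(φ w 0 − φ t 0), φ w 1 − φ t 1)`, unit steps);
# this file supplies p1-g11's kit clause `kitClauseA'` for its levels: unit steps `steps_rootFrame`, the four side forms **`rootSideU`** (raw on axis 0 with the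
# sign `σ` = `rawSideU` with `U = 1`; p1's level form `levSide` with the trivial shear `(n, h) = (1, 0)` on axis 1), all affine of slope `1`
# (`rootSideU_isAffine`), the chart compatibility `compat_rootFrame`, the exit pieces **`pexR`** (x-sides: the outward short side half `(σ₀σ, τ = 1)`;
# y-sides: the outward short top/bottom piece `(σ₀, τ = 1, v_s)`) with `pexR_spec`, and **`kitClause_rootFrame`** = `kitClause_runX` in the root frame

Kit constants: `P.A = nz + 2` (the `(κ)`-capture number at slope `U = 1`), `1 ≤ P.N`; exit rooms `nz + 3 ≤ n_s` (raw) and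
`(P.A + 1)·n_s ≤ n_s ℓ_s − U_s + 1 − |h_s|·n_s` (level, the slope-mismatch inequality of `exit_levSide_topPiece` at `(n_L, h_L) = (1, 0)`).
builds on p205010 (kernel theorem, internal audit signed; external expert review pending) — nothing in this file uses p205010; nothing here is a claim about the open node.
Lane `prim-bschramm`, seat `prim-bschramm-p3` (gen 9; design owner + (R) owner); helper file (`--supports stmt-CriticalPhenomena-4575 --as helper`); pattern = p1-g11's
`kitClause_runX` (SkelPhiRunKitClause). [cite: KozmaNitzan2024, §4 Lemma 10 (pp. 17–21), p. 28] [cite: MartineauTassion2017, §3.2, §4.3 Lemma 4.2]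
-/

noncomputable section

open scoped Classical

namespace Summit.CriticalPhenomena.PercolationContinuityZ3.Theorems.Transplant

namespace Skelφ

open MeasureTheory
open Literature.Probability.Percolation Literature.Probability.LatticeModels SimpleGraph KNLevels
open Literature.Barriers.CriticalPhenomena (graphBall graphBall_finite mem_graphBall_self graphBall_mono)
open Skel (winGraph winGraph_adj winGraph_le KitGeom)
open SkelI (tanOff tanTgt tanTgt_mem)
open Literature.Probability.Percolation.KozmaNitzan.Cells (oth oth_ne eq_oth_of_ne oth_oth)

variable {V : Type} [DecidableEq V] {G : SimpleGraph V} [G.LocallyFinite] {φ : V → Site 2}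

/-! ## §1 The root frame: unit steps, chart compatibility, side forms -/

omit [DecidableEq V] [G.LocallyFinite] in
/-- **The root frame has unit steps** (from those of `φ`; the sign on axis `0` is absorbed). [folklore] -/
theorem steps_rootFrame (hstep : Steps G φ) (t : V) {σ : ℤ} (hσ : σ = 1 ∨ σ = -1) : Steps G (rootFrame φ t σ) := by
  intro v i σ₀
  have h2 : σ * σ = 1 := by rcases hσ with rfl | rfl <;> simp
  fin_cases i
  · obtain ⟨v', hadj, hφ⟩ := hstep v 0 (σ₀ * sgnU σ)
    refine ⟨v', hadj, funext fun i => ?_⟩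
    have h0 : φ v' 0 = φ v 0 + (σ₀ : ℤ) * σ := by
      have := congrFun hφ 0; rw [Pi.add_apply, Pi.single_eq_same, Units.val_mul, val_sgnU hσ] at this; exact this
    have h1 : φ v' 1 = φ v 1 := by
      have := congrFun hφ 1; rwa [Pi.add_apply, Pi.single_eq_of_ne (by decide : (1 : Fin 2) ≠ 0), add_zero] at this
    fin_cases i <;> simp only [Fin.zero_eta, Fin.isValue, Fin.mk_one, Pi.add_apply]
    · rw [rootFrame_apply_zero, rootFrame_apply_zero, Pi.single_eq_same, h0]
      linear_combination (σ₀ : ℤ) * h2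
    · rw [rootFrame_apply_one, rootFrame_apply_one, Pi.single_eq_of_ne (by decide : (1 : Fin 2) ≠ 0), h1, add_zero]
  · obtain ⟨v', hadj, hφ⟩ := hstep v 1 σ₀
    refine ⟨v', hadj, funext fun i => ?_⟩
    have h0 : φ v' 0 = φ v 0 := by
      have := congrFun hφ 0; rwa [Pi.add_apply, Pi.single_eq_of_ne (by decide : (0 : Fin 2) ≠ 1), add_zero] at this
    have h1 : φ v' 1 = φ v 1 + (σ₀ : ℤ) := by
      have := congrFun hφ 1; rw [Pi.add_apply, Pi.single_eq_same] at this; exact this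
    fin_cases i <;> simp only [Fin.zero_eta, Fin.isValue, Fin.mk_one, Pi.add_apply]
    · rw [rootFrame_apply_zero, rootFrame_apply_zero, Pi.single_eq_of_ne (by decide : (0 : Fin 2) ≠ 1), h0, add_zero]
    · rw [rootFrame_apply_one, rootFrame_apply_one, Pi.single_eq_same, h1]; ring

omit [DecidableEq V] [G.LocallyFinite] in
/-- **Chart compatibility**: a `φ`-box of size `d` has root-frame diameter `≤ d + 1` (indeed `≤ d`). [folklore] -/
theorem compat_rootFrame (t : V) {σ : ℤ} (hσ : σ = 1 ∨ σ = -1) :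
    ∀ (v w : V) (d : ℕ), φ v - φ w ∈ box 2 d → ∀ i, |rootFrame φ t σ v i - rootFrame φ t σ w i| ≤ d + 1 := by
  intro v w d hvw i
  rw [mem_box] at hvw
  have h0 : |φ v 0 - φ w 0| ≤ d := by have := hvw 0; simp only [Pi.sub_apply] at this; exact abs_le.2 ⟨this.1, this.2⟩
  have h1 : |φ v 1 - φ w 1| ≤ d := by have := hvw 1; simp only [Pi.sub_apply] at this; exact abs_le.2 ⟨this.1, this.2⟩
  fin_cases i
  · show |rootFrame φ t σ v 0 - rootFrame φ t σ w 0| ≤ d + 1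
    rw [rootFrame_apply_zero, rootFrame_apply_zero, show σ * (φ v 0 - φ t 0) - σ * (φ w 0 - φ t 0) = σ * (φ v 0 - φ w 0) by ring, abs_mul,
      show |σ| = 1 by rcases hσ with h | h <;> simp [h], one_mul]
    linarith
  · show |rootFrame φ t σ v 1 - rootFrame φ t σ w 1| ≤ d + 1
    rw [rootFrame_apply_one, rootFrame_apply_one, show φ v 1 - φ t 1 - (φ w 1 - φ t 1) = φ v 1 - φ w 1 by ring]
    linarith

omit [DecidableEq V] [G.LocallyFinite] in
/-- The second root-frame coordinate is p1-g11's level coordinate with the trivial shear `(n, h, σ) = (1, 0, 1)`. [folklore] -/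
theorem rootFrame_one_eq_lev (t : V) (σ : ℤ) (w : V) : rootFrame φ t σ w 1 = (1 * shearCoord φ t 1 0 w) / (shearUnit 1 0 : ℕ) := by
  rw [rootFrame_apply_one]
  simp [shearCoord, shearUnit, relCoord]

/-- **The four side forms of a box of the root frame**: raw of slope `1` with the sign `σ` on axis `0`, level with trivial shear on axis `1`. [this work] -/
def rootSideU (t : V) {σ : ℤ} (hσ : σ = 1 ∨ σ = -1) (Lo Hi : Site 2) : ∀ (i : Fin 2) (σ₀ : ℤˣ), SideForm (rootFrame φ t σ) φ Lo Hi i σ₀ := fun i σ₀ =>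
  if hi : i = 0 then hi ▸ rawSideU (rootFrame φ t σ) t σ hσ (U := 1) le_rfl Lo Hi 0 σ₀ (fun w => by rw [rootFrame_apply_zero])
  else (eq_oth_of_ne hi : i = oth 0) ▸ levSide (rootFrame φ t σ) t (le_refl 1) 0 1 (Or.inl rfl) Lo Hi 1 σ₀ (rootFrame_one_eq_lev t σ)

omit [DecidableEq V] [G.LocallyFinite] in
/-- The root-frame side forms are affine of slope `1`, coefficient `1`. [folklore] -/
theorem rootSideU_isAffine (t : V) {σ : ℤ} (hσ : σ = 1 ∨ σ = -1) (Lo Hi : Site 2) (i : Fin 2) (σ₀ : ℤˣ) :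
    (rootSideU (φ := φ) t hσ Lo Hi i σ₀).IsAffine 1 1 := by
  fin_cases i <;> simp only [Fin.zero_eta, Fin.isValue, Fin.mk_one]
  · exact rawSideU_isAffine (ψ := rootFrame φ t σ) t σ hσ (U := 1) le_rfl Lo Hi 0 σ₀ (fun w => by rw [rootFrame_apply_zero])
  · have h := levSide_isAffine (ψ := rootFrame φ t σ) t (le_refl 1) 0 1 (Or.inl rfl) Lo Hi 1 σ₀ (rootFrame_one_eq_lev t σ)
    have e : ((shearUnit 1 0 : ℕ) : ℤ) = 1 := by simp [shearUnit]
    rw [e, Nat.cast_one] at h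
    exact h

/-! ## §2 The exit pieces -/

variable (G φ) in
/-- **The exit pieces of a root-frame level kit**: x-sides (`i = 0`) — the outward short side half `(σ₀σ, τ = 1)`; y-sides (`i = 1`) — the outward
short top/bottom piece `(σ₀, τ = 1, v_s)`. [cite: MartineauTassion2017, §3.2] -/
def pexR (Q : ShortPc V) (σ : ℤ) (i : Fin 2) (σ₀ : ℤˣ) (c : V) : Finset V :=
  if i = 0 then pgSideHalfW G φ c (Q.nS c) (Q.hS c) (Q.ℓS c) (Q.RS c) ((σ₀ : ℤ) * σ) 1
  else pgTopPieceW G φ c (Q.nS c) (Q.hS c) (Q.ℓS c) (Q.RS c) ((σ₀ : ℤ) * 1) 1 (Q.vS c)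

omit [DecidableEq V] in
/-- **The exit pieces of a root-frame kit lie below the shell lines** (raw: `A + 1 ≤ n_s`; level: `(A + 1)·n_s ≤ n_s ℓ_s − U_s + 1 − |h_s|·n_s`). [this work] -/
theorem pexR_spec (t : V) {σ : ℤ} (hσ : σ = 1 ∨ σ = -1) (Lo Hi : Site 2) (Q : ShortPc V) {A : ℤ}
    (hnS : ∀ c, 1 ≤ Q.nS c) (hexRaw : ∀ c, A + 1 ≤ Q.nS c)
    (hexLev : ∀ c, (A + 1) * Q.nS c ≤ (Q.nS c : ℤ) * Q.ℓS c - shearUnit (Q.nS c) (Q.hS c) + 1 - |Q.hS c| * Q.nS c)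
    (i : Fin 2) (σ₀ : ℤˣ) (c : V) : ∀ v ∈ pexR G φ Q σ i σ₀ c,
      (rootSideU (φ := φ) t hσ Lo Hi i σ₀).lin (φ v) + A +
        ((rootSideU (φ := φ) t hσ Lo Hi i σ₀).s : ℤ) * coef (rootSideU (φ := φ) t hσ Lo Hi i σ₀).cα
          (rootSideU (φ := φ) t hσ Lo Hi i σ₀).cβ (rootSideU (φ := φ) t hσ Lo Hi i σ₀).a ≤
      (rootSideU (φ := φ) t hσ Lo Hi i σ₀).lin (φ c) := by
  intro v hv
  fin_cases i <;> simp only [Fin.zero_eta, Fin.isValue, Fin.mk_one] at hv ⊢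
  · simp only [pexR, if_true] at hv
    have hA' : A + 1 ≤ 1 * (Q.nS c : ℤ) := by rw [one_mul]; exact hexRaw c
    exact exit_rawSideU_sideHalf (ψ := rootFrame φ t σ) t σ hσ (U := 1) le_rfl Lo Hi 0 σ₀ (fun w => by rw [rootFrame_apply_zero]) hA' hv
  · simp only [pexR, show ¬ ((1 : Fin 2) = 0) by decide, if_false] at hv
    have hex : (A + (1 : ℕ)) * Q.nS c ≤ ((1 : ℕ) : ℤ) * ((Q.nS c : ℤ) * Q.ℓS c - shearUnit (Q.nS c) (Q.hS c) + 1) -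
        |((1 : ℕ) : ℤ) * Q.hS c - 0 * Q.nS c| * Q.nS c := by
      have h := hexLev c
      simp only [Nat.cast_one, one_mul, zero_mul, sub_zero]
      linarith
    exact exit_levSide_topPiece (ψ := rootFrame φ t σ) t (le_refl 1) 0 1 (Or.inl rfl) Lo Hi 1 σ₀ (rootFrame_one_eq_lev t σ) (hnS c) hex hv

/-! ## §3 The kit clause of a root-frame window level -/

/-- **THE KIT CLAUSE OF A ROOT-FRAME WINDOW LEVEL.** Level box `[lo − j, hi + j]` of the frame `rootFrame φ t σ` around `w₀` (radius `R`);
kit constants `P` (`P.A = nz + 2`, `1 ≤ P.N`) with the placement numbers; short region `Rg`, zone family `Λc` (seed level `kz`, zone level `nz`), short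
piece data `Q` (pieces inside `Rg`, exit rooms); per contact: far ⇒ inner neighbour in the target; near ⇒ a face vertex in the target or the three
Step-IV inputs at the kit centre (zone, the exit link of the side's piece, the route datum). [cite: KozmaNitzan2024, §4 Lemma 10 (pp. 17–21)] -/
theorem kitClause_rootFrame [Countable V] {types : Finset V} (hlipφ : Lip G φ) (hstep : Steps G φ) (hfr : Frames G φ types) (hκ : CylConn G φ types)
    {Δ : ℕ} (hΔ : ∀ v, G.degree v ≤ Δ) {q : unitInterval} {δ : ℝ} (hδ : 0 < δ)
    -- the root frame
    (t : V) {σ : ℤ} (hσ : σ = 1 ∨ σ = -1)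
    -- the level box and the window
    {lo hi : Site 2} {j : ℕ} {w₀ : V} {R : ℕ}
    -- kit constants
    (P : ApronPrm) {nz Rs Kmax KCmax rs cS cU : ℕ} (hPN : 1 ≤ P.N) (hA : P.A = (nz : ℤ) + 2)
    (hd1 : P.W + P.ℓ ≤ P.d) (hD1 : P.W + P.ℓ + P.d + 2 ≤ shellD P) (hD2 : P.ℓ + Rs + P.d + 3 ≤ shellD P) (hDρ : Rs + 1 ≤ shellD P)
    (hℓ : 1 ≤ P.ℓ) (hW : Rs + P.ℓ ≤ P.W) (hKmax : shellD P + P.W ≤ Kmax) (hKCmax : shellD P + nz + 1 ≤ KCmax)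
    (hR' : cylRadMax G φ types P.ℓ (Rs + KCmax + (P.W + Kmax)) ≤ P.R')
    (hwide : ∀ i, (lo - (j : Site 2)) i + 2 * tanOff P.ℓs P.M ≤ (hi + (j : Site 2)) i)
    (hdw : ∀ i, (lo - (j : Site 2)) i + (P.d + 2 : ℕ) ≤ (hi + (j : Site 2)) i)
    (hDw : ∀ i, (lo - (j : Site 2)) i + ((shellD P + 1 + P.d + KCmax + Rs : ℕ) : ℤ) ≤ (hi + (j : Site 2)) i)
    (hT : (P.W : ℤ) + Kmax + P.ℓ + 1 ≤ tanOff P.ℓs P.M) (hT' : (shellD P : ℤ) + KCmax + Rs ≤ tanOff P.ℓs P.M)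
    (hr₀ : P.N * (tanOff P.ℓs P.M + 2) + P.N * P.d + (P.W + Kmax + P.R') + (KCmax + Rs) ≤ P.r₀) (hR : P.r₀ ≤ R)
    (hrs : 2 * (1 + P.N * (tanOff P.ℓs P.M + 2) + P.N * P.d + (P.W + Kmax + P.R') + (KCmax + Rs)) ≤ rs)
    (hcS : (P.N + 1) * (tanOff P.ℓs P.M + 1) + (P.N + 1) * P.d + (2 * P.W + 1) * (Kmax + 1) * (Δ + 1) ^ P.R' ≤ cS)
    -- the short region, the zone family, the short pieces
    (Rg : V → Finset V) (hRg : ∀ c, ∀ u ∈ Rg c, u ∈ graphBall G c Rs) (hRgcard : ∀ c, (Rg c).card ≤ cU) (hcU1 : 1 ≤ cU)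
    (Λc : V → ℕ → Finset V) (kz : ℕ) (hkn : ∀ c, Λc c kz ⊆ Λc c nz) (hΛ : ∀ c, ∀ v ∈ Λc c nz, v ∈ Rg c ∧ φ v - φ c ∈ box 2 nz)
    (Q : ShortPc V) (hQRg : ∀ i σ₀ c, pexR G φ Q σ i σ₀ c ⊆ Rg c) (hnS : ∀ c, 1 ≤ Q.nS c) (hexRaw : ∀ c, nz + 3 ≤ Q.nS c)
    (hexLev : ∀ c, (P.A + 1) * Q.nS c ≤ (Q.nS c : ℤ) * Q.ℓS c - shearUnit (Q.nS c) (Q.hS c) + 1 - |Q.hS c| * Q.nS c)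
    -- the level's source/support, the weighting, the region and the target
    (k : ℕ) (o : V) (Sfin : Finset V) {Wt : Sym2 V → unitInterval} {D T : Finset V} (hWD : IsSubbox (winGraph G w₀ R) Wt q D)
    (hXD : winLevel G (rootFrame φ t σ) w₀ R lo hi j ⊆ D) {N : ℕ} (hN : k * (Δ + 1) ^ (2 * rs) ≤ N)
    (hk : (1 - (q : ℝ) ^ (1 + Δ * cS + cS * cU)) ^ k ≤ δ)
    -- per contact
    (hfar : ∀ x ∈ outerBoundary (winGraph G w₀ R) (winLevel G (rootFrame φ t σ) w₀ R lo hi j),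
      ¬ IsNear G (rootFrame φ t σ) (lo - (j : Site 2)) (hi + (j : Site 2)) P w₀ R x →
      ctY G (rootFrame φ t σ) w₀ R (lo - (j : Site 2)) (hi + (j : Site 2)) x ∈ T)
    (hnear' : ∀ x ∈ outerBoundary (winGraph G w₀ R) (winLevel G (rootFrame φ t σ) w₀ R lo hi j),
      IsNear G (rootFrame φ t σ) (lo - (j : Site 2)) (hi + (j : Site 2)) P w₀ R x →
      (∃ u ∈ ctFace G (rootSideU (φ := φ) t hσ (lo - (j : Site 2)) (hi + (j : Site 2))) Rg P w₀ R x, u ∈ T) ∨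
      (1 - δ ^ 2 < (bondPercolation G q).real
          (UniqZone.zone G (Λc (ctCtr G (rootSideU (φ := φ) t hσ (lo - (j : Site 2)) (hi + (j : Site 2))) P w₀ R x)) kz nz) ∧
        1 - δ ^ 2 < (bondPercolation G q).real
          (linkIn (↑(Rg (ctCtr G (rootSideU (φ := φ) t hσ (lo - (j : Site 2)) (hi + (j : Site 2))) P w₀ R x)) : Set V)
            (Λc (ctCtr G (rootSideU (φ := φ) t hσ (lo - (j : Site 2)) (hi + (j : Site 2))) P w₀ R x) kz)
            (pexR G φ Q σ (ctDir G (rootFrame φ t σ) w₀ R (lo - (j : Site 2)) (hi + (j : Site 2)) x).1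
              (ctDir G (rootFrame φ t σ) w₀ R (lo - (j : Site 2)) (hi + (j : Site 2)) x).2
              (ctCtr G (rootSideU (φ := φ) t hσ (lo - (j : Site 2)) (hi + (j : Site 2))) P w₀ R x))) ∧
        ∃ Qt Ft : Finset V, Ft ⊆ T ∧ Qt ⊆ D ∧
          Disjoint Ft (Λc (ctCtr G (rootSideU (φ := φ) t hσ (lo - (j : Site 2)) (hi + (j : Site 2))) P w₀ R x) nz) ∧
          1 - δ ^ 2 < (prodBernoulli Wt).real (linkIn (↑Qt : Set V)
            (Λc (ctCtr G (rootSideU (φ := φ) t hσ (lo - (j : Site 2)) (hi + (j : Site 2))) P w₀ R x) kz) Ft))) :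
    ∃ (σ' : SData V) (S : Finset V), SHyp (winLData G (rootFrame φ t σ) w₀ R lo hi o Sfin) j σ' ∧ σ'.N ≤ N ∧
      (1 - (q : ℝ) ^ σ'.sB) ^ σ'.k ≤ δ ∧ S ⊆ (winLData G (rootFrame φ t σ) w₀ R lo hi o Sfin).X j ∧ S ⊆ D ∧
      (∀ x ∈ σ'.K, ∀ e ∈ σ'.seed x, e ∉ wireSet (↑S : Set V)) ∧ (∀ x ∈ σ'.K, σ'.face x ⊆ S) ∧
      (∀ x ∈ σ'.K, 1 - 3 * δ ≤ (prodBernoulli Wt).real {ω | ∃ u ∈ σ'.face x,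
        1 - δ < (prodBernoulli (pinW Wt (wireSet (↑S : Set V)) ω)).real (⋃ t ∈ T, openConnIn (↑D : Set V) u t)}) := by
  set SF := rootSideU (φ := φ) t hσ (lo - (j : Site 2)) (hi + (j : Site 2)) with hSF
  have hU1 : (1 : ℤ) ≤ 1 := le_rfl
  have haff : ∀ (i : Fin 2) (σ₀ : ℤˣ), (SF i σ₀).IsAffine 1 ((fun _ _ => (1 : ℤ)) i σ₀) := fun i σ₀ => by
    rw [hSF]; exact rootSideU_isAffine t hσ _ _ i σ₀
  have hC : ∀ (i : Fin 2) (σ₀ : ℤˣ), ((1 : ℕ) : ℤ) ≤ (fun _ _ => (1 : ℤ)) i σ₀ := fun _ _ => by simp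
  have hU : (1 : ℤ) ≤ ((0 + 1 : ℕ) : ℤ) * (1 : ℕ) := by simp
  have hA' : P.A = ((nz + 1 : ℕ) : ℤ) * 1 + 1 := by rw [hA]; push_cast; ring
  have hA0 : 0 ≤ P.A := by rw [hA]; positivity
  have hdD : P.d + 2 ≤ shellD P := by omega
  have hKmax' : (shellD P + P.W) * (0 + 1) ≤ Kmax := by simpa using hKmax
  have hKCmax' : (shellD P + nz + 1) * (0 + 1) ≤ KCmax := by simpa using hKCmax
  have hexRaw' : ∀ c, P.A + 1 ≤ Q.nS c := fun c => by rw [hA]; have := hexRaw c; omega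
  refine kitClauseA' SF Rg (lip_rootFrame hlipφ t hσ) ((qStepsN_of_steps (steps_rootFrame hstep t hσ)).mono hPN) hlipφ hstep hfr hκ hΔ hδ hℓ
    hwide hdw hdD hDw hDρ
    (hbelow_of_affine SF haff hU1 P hD1) (habove_of_affine SF haff hU1 P hd1) (hK_of_affine SF haff hU1 P (le_refl 1) hC hU hKmax')
    (fun i σ₀ z hz _ => hKC_of_affine SF haff hU1 P (le_refl 1) hC hU hA' hKCmax' i σ₀ z hz) (hθA_of_affine SF haff hU1 P hA0 hdD)
    (hAz_of_affine SF haff P hA') (hcap_of_affine SF haff hU1 P hD2) (compat_rootFrame t hσ) hT hT' hW hR' hRg hRgcard hcU1 hr₀ hR hrs hcS Λc hkn hΛ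
    (pexR G φ Q σ) (fun i σ₀ c v hv => ⟨hQRg i σ₀ c hv, ?_⟩) k o Sfin hWD hXD hN hk hfar hnear'
  rw [hSF]
  exact pexR_spec t hσ _ _ Q hnS hexRaw' hexLev i σ₀ c v hv

end Skelφ

end Summit.CriticalPhenomena.PercolationContinuityZ3.Theorems.Transplant

end
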